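import Literature.NumberTheory.Weil1965.ThetaIntegralOrbitFunctional
import Literature.NumberTheory.Weil1964.AdelicDoublingGeometricFrame
import Literature.NumberTheory.GelbartRogawski1991.UnitaryDualPairSplittingDatum
import Literature.NumberTheory.Automorphic.UnitaryGroupOfFormAdelicTopology
import HarnessLib

/-!
# The theta-side orbit functional of a unitary dual pair `(U(J_V), U(J_W))`, `J_W` of rank one, in the doubled
# Schrödinger model: the geometric action `A_h = diagAct(ι_V h)` and THE STRUCTURE IDENTITY of the doubled theta integral

Topic `NumberTheory/Weil1965`; namespace `Literature.NumberTheory.Weil1965.UnitaryDoubling`.  KERNEL MATHEMATICS ONLY: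
definitions with bodies and theorems; no `def … : Prop` record, no `axiom`, no proof hole.  Cell `hodgecm-mathlib`, floor-0
line P4, engine E-2, row I-STRUCT-I (consumer: the child line `Cruxes/H413/Lines/F0_E2SiegelWeilWeilRange`, whose in-file
carrier `vDiagLift = doublingLift ∘ toSp ∘ adelicInl` and functional `doubledThetaIntegral ν Ψ = ∫ Θ(ω□(vDiagLift h̃⁻¹)Ψ) dν`
appear here with their bodies).

THE MATHEMATICS ([Weil1965, n° 52] for the doubled pair `(U(J_V), U(W ⊕ W⁻))`): in Weil's frame `X = V ⊗ ℓ*` the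
`V`-member acts on `𝒮(X_𝔸)` geometrically, so the theta integral unfolds over the rational points `ξ ∈ X_k` and their
`U(J_V)(𝔸)`-orbits: `∫_{[U(J_V)]} Σ_{ξ} Φ(h̃ ξ) dν = ν([U(J_V)])·Φ(0) + ∫ Σ_{ξ ≠ 0} Φ(h̃ ξ) dν`.  In the tree's
frame (B) (Li's `δ`, ★ `AdelicDoublingGeometricFrame`) the test function is `Ψ♮ = geomFrame Ψ` and the action is
`A_h = diagAct (ι_V h)`.
* §1 (generic complements to ★ `AdelicDoublingGeometricFrame`) `diagAct` of a transported matrix is the matrix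
  (`diagAct_transportSp_apply`); `diagAct` of a RATIONAL symplectic matrix maps `ratPt` to `ratPt` (`diagAct_ratSp_ratPt`).
* §2 `iotaV = toSp ∘ adelicInl : U(J_V)(𝔸) →* Sp(𝕎_𝔸)`, **`vDiagAct = diagAct ∘ iotaV : U(J_V)(𝔸) →* GL(X□(𝔸))`**, its
  RATIONALITY on `U(J_V)(F)` (`vDiagAct_ratPt_of_mem`, from ★ `toSp_mem_range_ratSp`) and the CONTINUITY of its orbit maps
  (`continuous_iotaV_apply`, `continuous_vDiagAct_apply`: entries of the restriction of scalars are polynomial in those of `h`)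
  — the hypotheses `hΓ`, `hA` of ★ `Weil1965.orbitFunctional`; hence **`thetaOrbitFunctional ν`**, the theta-side orbit
  functional of the dual pair, and its real form `thetaOrbitFunctionalReal ν` (positive: `thetaOrbitFunctionalReal_nonneg`;
  invariant: `thetaOrbitFunctional_comp`).
* §3 the integrand pointwise `Θ(ω□(IV□ h̃⁻¹)Ψ) = Ψ♮(0) + Σ'_{ξ ≠ 0} Ψ♮(A_h̃ ξ)` (`thetaDistLM_omega_vDiagLift_inv`) and
  **THE STRUCTURE IDENTITY** `I□ Ψ = ν(univ)·Ψ♮(0) + thetaOrbitFunctional ν Ψ♮`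
  (`doubledThetaIntegral_eq_measure_mul_apply_zero_add_thetaOrbitFunctional`); `Ψ♮(0) = ev0 Ψ` is ★ `geomFrame_apply_zero`.

## References
* [Weil1965] A. Weil, *Sur la formule de Siegel dans la théorie des groupes classiques*, Acta Math. 113 (1965), n° 52
  (theta integral of the doubled pair over rational orbits), Chap. I n° 2 Lemme 3 p. 7, n° 45.
* [Weil1964] A. Weil, Acta Math. 111 (1964), Chap. III n° 37 p. 188 (rational points), n° 39 p. 189, n° 41 Thm 6 p. 193.
* [GelbartRogawski1991] S. Gelbart, J. Rogawski, Invent. Math. 105 (1991), §3.1 pp. 454–455 (`ι`, rational points).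
* [Kudla1996] S. S. Kudla, *Notes on the local theta correspondence*, I.2.
-/

set_option autoImplicit false

noncomputable section

namespace Literature.NumberTheory.Weil1965.UnitaryDoubling

open scoped Matrix
open _root_.MeasureTheory NumberField
open Literature.RepresentationTheory.HeisenbergGroup
open Literature.RepresentationTheory.HeisenbergGroup.SymplecticMatrix
open Literature.NumberTheory.Weil1964 Literature.NumberTheory.Weil1965 Literature.NumberTheory.Automorphic
open Literature.NumberTheory.Automorphic.UnitaryGroup (spReindex reindexW coe_spReindex_apply reindexW_apply reindexW_symm_apply
  isQuadraticCoordinates_adele quadraticAdeleEquiv)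
open Literature.NumberTheory.Automorphic.UnitaryGroup.QuadraticCoordinates
open Literature.NumberTheory.GelbartRogawski1991 Literature.NumberTheory.GelbartRogawski1991.UnitaryDualPair

/-! ## §1 Generic complements to ★ `AdelicDoublingGeometricFrame`: `diagAct` of a transported ∕ rational matrix -/

section DiagActRat

variable (F : Type) [Field F] [NumberField F] {n : ℕ}
variable (T : Matrix (Fin n) (Fin n) (AdeleRing (𝓞 F) F)) (hT : IsUnit T.det)

/-- **`diagAct` of a transported matrix is the matrix** (the Darboux transports cancel):
`a_{P⁻¹MP} x = (M ·)` read through `finSumFinEquiv`. [cite: Kudla1996, I.2] -/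
theorem diagAct_transportSp_apply (M : Matrix.symplecticGroup (Fin n) (AdeleRing (𝓞 F) F)) (x : Fin (n + n) → AdeleRing (𝓞 F) F) :
    diagAct F T hT (transportSp T hT M) x =
      ((M : Matrix (Fin n ⊕ Fin n) (Fin n ⊕ Fin n) (AdeleRing (𝓞 F) F)) *ᵥ (x ∘ ⇑finSumFinEquiv)) ∘ ⇑finSumFinEquiv.symm := by
  rw [diagAct_apply, coe_transportSp_apply, LinearEquiv.apply_symm_apply, LinearEquiv.apply_symm_apply]

/-- **`diagAct` of a RATIONAL symplectic matrix maps rational points to rational points**: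
`a_{ratSp γ} (ratPt ξ) = ratPt (γ ξ)` (read through `finSumFinEquiv`). [cite: Weil1964, Chap. III n° 37 p. 188] -/
theorem diagAct_ratSp_ratPt (γ : Matrix.symplecticGroup (Fin n) F) (ξ : Fin (n + n) → F) :
    diagAct F T hT (ratSp F T hT γ) (ratPt F (Fin (n + n)) ξ) =
      ratPt F (Fin (n + n)) ((((γ : Matrix (Fin n ⊕ Fin n) (Fin n ⊕ Fin n) F) *ᵥ (ξ ∘ ⇑finSumFinEquiv)) ∘ ⇑finSumFinEquiv.symm)) := by
  have h : ratSp F T hT γ = transportSp T hT (mapHom (algebraMap F (AdeleRing (𝓞 F) F)) γ) := rfl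
  rw [h, diagAct_transportSp_apply, coe_mapHom]
  funext i
  simp only [Function.comp_apply, ratPt_apply]
  rw [RingHom.map_mulVec]
  rfl

end DiagActRat

/-! ## §2 The dual pair: `ι_V`, the geometric action `A = diagAct ∘ ι_V`, rationality, continuity, the functional -/

section DualPair

variable (F E : Type) [Field F] [NumberField F] [Field E] [NumberField E] [Algebra F E] [Algebra.IsQuadraticExtension F E]
  (c : E ≃ₐ[F] E) {δ : E} (hcδ : c δ = -δ) (hδ : δ ≠ 0) {d : F} (hd : δ * δ = algebraMap F E d)
  (N : ℕ) {n : ℕ} (e : Fin N × Fin 1 ≃ Fin n)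
  (TV : Matrix (Fin N) (Fin N) F) (hV : TV.IsSymm) (hVd : IsUnit TV.det)
  (TW : Matrix (Fin 1) (Fin 1) F) (hW : TW.IsSymm) (hWd : IsUnit TW.det)

/-- **`ι_V : U(J_V)(𝔸) →* Sp(𝕎_𝔸)`**, `h ↦ ι(h ⊗ 1)` (the child line's `toSp ∘ adelicInl`). [cite: GelbartRogawski1991, §3.1 p. 454] -/
def iotaV : UnitaryGroup.adelic F E c N (TV.map (algebraMap F E)) →* symplecticGroup (polar (adelicForm F (Fin n) (adelicGram F e TV TW))) :=
  (toSp F E c N 1 e (TV.map (algebraMap F E)) (TW.map (algebraMap F E)) hcδ hδ hd hV hW rfl rfl).comp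
    (UnitaryGroup.adelicInl F E c N 1 (TV.map (algebraMap F E)) (TW.map (algebraMap F E)))

/-- unfolding (definitional). [cite: GelbartRogawski1991, §3.1 p. 454] -/
theorem iotaV_eq : iotaV F E c hcδ hδ hd N e TV hV TW hW =
    (toSp F E c N 1 e (TV.map (algebraMap F E)) (TW.map (algebraMap F E)) hcδ hδ hd hV hW rfl rfl).comp
    (UnitaryGroup.adelicInl F E c N 1 (TV.map (algebraMap F E)) (TW.map (algebraMap F E))) := rfl

/-- **the geometric action `A_h := diagAct (ι_V h)` of `U(J_V)(𝔸)` on `X□(𝔸) = 𝔸_F^{n+n}`** (★ `diagAct` of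
`AdelicDoublingGeometricFrame` along `ι_V`). [cite: Weil1965, n° 52] -/
def vDiagAct : UnitaryGroup.adelic F E c N (TV.map (algebraMap F E)) →* ((Fin (n + n) → AdeleRing (𝓞 F) F) ≃ₗ[AdeleRing (𝓞 F) F] (Fin (n + n) → AdeleRing (𝓞 F) F)) :=
  (diagAct F (adelicGram F e TV TW) (isUnit_det_adelicGram F e hVd hWd)).comp (iotaV F E c hcδ hδ hd N e TV hV TW hW)

/-- unfolding. [cite: Weil1965, n° 52] -/
theorem vDiagAct_apply (h : UnitaryGroup.adelic F E c N (TV.map (algebraMap F E))) : vDiagAct F E c hcδ hδ hd N e TV hV hVd TW hW hWd h = diagAct F (adelicGram F e TV TW) (isUnit_det_adelicGram F e hVd hWd) (iotaV F E c hcδ hδ hd N e TV hV TW hW h) := rfl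

/-- **RATIONALITY**: a rational point `γ ∈ U(J_V)(F)` permutes the rational points of `X□(𝔸)` —
`A_γ (ratPt ξ) = ratPt ξ'` (`ι_V(γ) ∈ r(Sp_F)`, ★ `toSp_mem_range_ratSp`, and `diagAct_ratSp_ratPt`): hypothesis `hΓ` of
★ `Weil1965.orbitFunctional`. [cite: GelbartRogawski1991, §3.1 p. 455] -/
theorem vDiagAct_ratPt_of_mem (γ : UnitaryGroup.adelic F E c N (TV.map (algebraMap F E))) (hγ : γ ∈ (UnitaryGroup.toAdelic F E c N (TV.map (algebraMap F E))).range) (ξ : Fin (n + n) → F) :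
    ∃ ξ' : Fin (n + n) → F, vDiagAct F E c hcδ hδ hd N e TV hV hVd TW hW hWd γ (ratPt F (Fin (n + n)) ξ) = ratPt F (Fin (n + n)) ξ' := by
  obtain ⟨γ₀, rfl⟩ := hγ
  obtain ⟨M, hM⟩ := toSp_mem_range_ratSp F E c N 1 e (TV.map (algebraMap F E)) (TW.map (algebraMap F E)) hcδ hδ hd hV hW hVd hWd
    rfl rfl _ (UnitaryGroup.adelicInl_toAdelic_mem_range F E c N 1 (TV.map (algebraMap F E)) (TW.map (algebraMap F E)) γ₀)
  refine ⟨(((M : Matrix (Fin n ⊕ Fin n) (Fin n ⊕ Fin n) F) *ᵥ (ξ ∘ ⇑finSumFinEquiv)) ∘ ⇑finSumFinEquiv.symm), ?_⟩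
  rw [vDiagAct_apply, iotaV_eq, MonoidHom.comp_apply, ← hM]
  exact diagAct_ratSp_ratPt F (adelicGram F e TV TW) (isUnit_det_adelicGram F e hVd hWd) M ξ

/-- continuity of `h ↦ ι_V(h) w` on `U(J_V)(𝔸)` (`ι_V = spReindex e ∘ resAut ∘ (· ⊗ 1)`; entries of the restriction of scalars are
polynomial in the entries of `h`, `re`∕`im` are continuous on `𝔸_E`). [cite: GelbartRogawski1991, Prop. 3.1.1 p. 455 L1–2] -/
theorem continuous_iotaV_apply (w : ((Fin n → AdeleRing (𝓞 F) F) × (Fin n → AdeleRing (𝓞 F) F))) :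
    Continuous fun h : UnitaryGroup.adelic F E c N (TV.map (algebraMap F E)) =>
      ((iotaV F E c hcδ hδ hd N e TV hV TW hW h : symplecticGroup (polar (adelicForm F (Fin n) (adelicGram F e TV TW)))) : ((Fin n → AdeleRing (𝓞 F) F) × (Fin n → AdeleRing (𝓞 F) F)) ≃ₗ[AdeleRing (𝓞 F) F] ((Fin n → AdeleRing (𝓞 F) F) × (Fin n → AdeleRing (𝓞 F) F))) w := by
  have hre : Continuous (re (quadraticAdeleEquiv F E c hcδ hδ).toAddEquiv) :=
    continuous_re _ (quadraticAdeleEquiv F E c hcδ hδ).symm.continuous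
  have him : Continuous (im (quadraticAdeleEquiv F E c hcδ hδ).toAddEquiv) :=
    continuous_im _ (quadraticAdeleEquiv F E c hcδ hδ).symm.continuous
  have hM : Continuous fun h : UnitaryGroup.adelic F E c N (TV.map (algebraMap F E)) =>
      (((UnitaryGroup.adelicInl F E c N 1 (TV.map (algebraMap F E)) (TW.map (algebraMap F E)) h :
        UnitaryGroup.adelicPair F E c N 1 (TV.map (algebraMap F E)) (TW.map (algebraMap F E))) :
          GL (Fin N × Fin 1) (AdeleRing (𝓞 E) E)) : Matrix (Fin N × Fin 1) (Fin N × Fin 1) (AdeleRing (𝓞 E) E)) :=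
    Units.continuous_val.comp (continuous_subtype_val.comp
      (UnitaryGroup.continuous_adelicInl F E c N 1 (TV.map (algebraMap F E)) (TW.map (algebraMap F E))))
  have hreM : Continuous fun h : UnitaryGroup.adelic F E c N (TV.map (algebraMap F E)) =>
      ((((UnitaryGroup.adelicInl F E c N 1 (TV.map (algebraMap F E)) (TW.map (algebraMap F E)) h :
        UnitaryGroup.adelicPair F E c N 1 (TV.map (algebraMap F E)) (TW.map (algebraMap F E))) :
          GL (Fin N × Fin 1) (AdeleRing (𝓞 E) E)) : Matrix (Fin N × Fin 1) (Fin N × Fin 1) (AdeleRing (𝓞 E) E)).map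
            (re (quadraticAdeleEquiv F E c hcδ hδ).toAddEquiv)) :=
    continuous_matrix fun i j => hre.comp (hM.matrix_elem i j)
  have himM : Continuous fun h : UnitaryGroup.adelic F E c N (TV.map (algebraMap F E)) =>
      ((((UnitaryGroup.adelicInl F E c N 1 (TV.map (algebraMap F E)) (TW.map (algebraMap F E)) h :
        UnitaryGroup.adelicPair F E c N 1 (TV.map (algebraMap F E)) (TW.map (algebraMap F E))) :
          GL (Fin N × Fin 1) (AdeleRing (𝓞 E) E)) : Matrix (Fin N × Fin 1) (Fin N × Fin 1) (AdeleRing (𝓞 E) E)).map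
            (im (quadraticAdeleEquiv F E c hcδ hδ).toAddEquiv)) :=
    continuous_matrix fun i j => him.comp (hM.matrix_elem i j)
  -- `ι_V(h) w = W_e (resAut (h ⊗ 1) (W_e⁻¹ w))` (definitional), and `resAut` in block form
  have hfun : (fun h : UnitaryGroup.adelic F E c N (TV.map (algebraMap F E)) =>
      ((iotaV F E c hcδ hδ hd N e TV hV TW hW h :
        symplecticGroup (polar (adelicForm F (Fin n) (adelicGram F e TV TW)))) : ((Fin n → AdeleRing (𝓞 F) F) × (Fin n → AdeleRing (𝓞 F) F)) ≃ₗ[AdeleRing (𝓞 F) F] ((Fin n → AdeleRing (𝓞 F) F) × (Fin n → AdeleRing (𝓞 F) F))) w) =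
      fun h => reindexW (AdeleRing (𝓞 F) F) e ((isQuadraticCoordinates_adele E c hcδ hδ hd).resAut (Fin N × Fin 1)
        ((UnitaryGroup.adelicInl F E c N 1 (TV.map (algebraMap F E)) (TW.map (algebraMap F E)) h :
          UnitaryGroup.adelicPair F E c N 1 (TV.map (algebraMap F E)) (TW.map (algebraMap F E))) :
            GL (Fin N × Fin 1) (AdeleRing (𝓞 E) E)) (w.1 ∘ ⇑e, w.2 ∘ ⇑e)) := rfl
  rw [hfun]
  simp only [(isQuadraticCoordinates_adele E c hcδ hδ hd).resAut_apply_mk]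
  have hW : Continuous fun v : (Fin N × Fin 1 → AdeleRing (𝓞 F) F) × (Fin N × Fin 1 → AdeleRing (𝓞 F) F) =>
      reindexW (AdeleRing (𝓞 F) F) e v :=
    (continuous_pi fun i => (continuous_apply (e.symm i)).comp continuous_fst).prodMk
      (continuous_pi fun i => (continuous_apply (e.symm i)).comp continuous_snd)
  refine hW.comp (Continuous.prodMk ?_ ?_)
  · exact (hreM.matrix_mulVec continuous_const).add
      ((continuous_const_smul (algebraMap F (AdeleRing (𝓞 F) F) d)).comp (himM.matrix_mulVec continuous_const))
  · exact (himM.matrix_mulVec continuous_const).add (hreM.matrix_mulVec continuous_const)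

/-- `θ_T` read through `finSumFinEquiv` is continuous: `v ↦ (Sum.elim v.1 (T v.2)) ∘ e⁻¹`. [folklore] -/
private theorem continuous_darboux_comp {m : ℕ} (T : Matrix (Fin m) (Fin m) (AdeleRing (𝓞 F) F)) (hT : IsUnit T.det) :
    Continuous fun v : (Fin m → AdeleRing (𝓞 F) F) × (Fin m → AdeleRing (𝓞 F) F) =>
      (darboux T hT v : Fin m ⊕ Fin m → AdeleRing (𝓞 F) F) ∘ ⇑(finSumFinEquiv (m := m) (n := m)).symm := by
  refine continuous_pi fun i => ?_
  simp only [Function.comp_apply, darboux_apply]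
  rcases finSumFinEquiv.symm i with j | j
  · simp only [Sum.elim_inl]
    exact (continuous_apply j).comp continuous_fst
  · simp only [Sum.elim_inr]
    exact (continuous_apply j).comp (continuous_const.matrix_mulVec continuous_snd)

/-- **CONTINUITY of the orbit maps `h ↦ A_h x`** of the geometric action (hypothesis `hA` of ★
`Weil1965.orbitFunctional`). [cite: Weil1964, Chap. III n° 39 p. 189] -/
theorem continuous_vDiagAct_apply (x : (Fin (n + n) → AdeleRing (𝓞 F) F)) : Continuous fun h : UnitaryGroup.adelic F E c N (TV.map (algebraMap F E)) => (vDiagAct F E c hcδ hδ hd N e TV hV hVd TW hW hWd) h x := by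
  have h1 : (fun h : UnitaryGroup.adelic F E c N (TV.map (algebraMap F E)) => (vDiagAct F E c hcδ hδ hd N e TV hV hVd TW hW hWd) h x) =
      (fun v : ((Fin n → AdeleRing (𝓞 F) F) × (Fin n → AdeleRing (𝓞 F) F)) => (darboux (adelicGram F e TV TW) (isUnit_det_adelicGram F e hVd hWd) v : Fin n ⊕ Fin n → AdeleRing (𝓞 F) F) ∘ ⇑(finSumFinEquiv (m := n) (n := n)).symm) ∘
        fun h : UnitaryGroup.adelic F E c N (TV.map (algebraMap F E)) => (((iotaV F E c hcδ hδ hd N e TV hV TW hW) h :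
          symplecticGroup (polar (adelicForm F (Fin n) (adelicGram F e TV TW)))) : ((Fin n → AdeleRing (𝓞 F) F) × (Fin n → AdeleRing (𝓞 F) F)) ≃ₗ[AdeleRing (𝓞 F) F] ((Fin n → AdeleRing (𝓞 F) F) × (Fin n → AdeleRing (𝓞 F) F)))
            ((darboux (adelicGram F e TV TW) (isUnit_det_adelicGram F e hVd hWd)).symm (x ∘ ⇑finSumFinEquiv)) := rfl
  rw [h1]
  exact (continuous_darboux_comp F (adelicGram F e TV TW) (isUnit_det_adelicGram F e hVd hWd)).comp (continuous_iotaV_apply F E c hcδ hδ hd N e TV hV TW hW _)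

/-! ## §3 The theta-side orbit functional of the dual pair and THE STRUCTURE IDENTITY -/

/-- **the integrand of `I□`, pointwise**: `Θ(ω□(IV□(h̃⁻¹))Ψ) = Ψ♮(0) + Σ'_{ξ ≠ 0} Ψ♮(A_h̃ ξ)` — ★ `hasSum_thetaDist_omega_doublingLift`
at `g = ι_V(h̃⁻¹)` (so `a_{g⁻¹} = A_h̃`), the origin term split off by ★ `tsum_eq_apply_zero_add_orbitSum`. [cite: Weil1965, n° 52] -/
theorem thetaDistLM_omega_vDiagLift_inv (Ψ : piSchwartzBruhat F (Fin (n + n))) (h : UnitaryGroup.adelic F E c N (TV.map (algebraMap F E))) :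
    thetaDistLM F (Fin (n + n))
        (adelicMpCont.omega F (Fin (n + n)) (doubledGramFin F (adelicGram F e TV TW))
          (((doublingLift F (adelicGram F e TV TW) (isUnit_det_adelicGram F e hVd hWd)).comp (iotaV F E c hcδ hδ hd N e TV hV TW hW)) h⁻¹) Ψ) =
      ((geomFrame F (adelicGram F e TV TW) (isUnit_det_adelicGram F e hVd hWd) Ψ : piSchwartzBruhat F (Fin (n + n))) : (Fin (n + n) → AdeleRing (𝓞 F) F) → ℂ) 0 +
        orbitSum F (vDiagAct F E c hcδ hδ hd N e TV hV hVd TW hW hWd) ((geomFrame F (adelicGram F e TV TW) (isUnit_det_adelicGram F e hVd hWd) Ψ : piSchwartzBruhat F (Fin (n + n))) : (Fin (n + n) → AdeleRing (𝓞 F) F) → ℂ) h := by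
  have h2 := (hasSum_thetaDist_omega_doublingLift F (adelicGram F e TV TW) (isUnit_det_adelicGram F e hVd hWd) ((iotaV F E c hcδ hδ hd N e TV hV TW hW) h⁻¹) Ψ).tsum_eq
  have h3 : ((iotaV F E c hcδ hδ hd N e TV hV TW hW) h⁻¹)⁻¹ = (iotaV F E c hcδ hδ hd N e TV hV TW hW) h := by rw [map_inv, inv_inv]
  have h4 : (∑' ξ : Fin (n + n) → F, ((geomFrame F (adelicGram F e TV TW) (isUnit_det_adelicGram F e hVd hWd) Ψ : piSchwartzBruhat F (Fin (n + n))) : (Fin (n + n) → AdeleRing (𝓞 F) F) → ℂ)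
      (diagAct F (adelicGram F e TV TW) (isUnit_det_adelicGram F e hVd hWd) ((iotaV F E c hcδ hδ hd N e TV hV TW hW) h⁻¹)⁻¹ (ratPt F (Fin (n + n)) ξ))) =
      ∑' ξ : Fin (n + n) → F, ((geomFrame F (adelicGram F e TV TW) (isUnit_det_adelicGram F e hVd hWd) Ψ : piSchwartzBruhat F (Fin (n + n))) : (Fin (n + n) → AdeleRing (𝓞 F) F) → ℂ) ((vDiagAct F E c hcδ hδ hd N e TV hV hVd TW hW hWd) h (ratPt F (Fin (n + n)) ξ)) :=
    tsum_congr fun ξ => congrArg (fun g => ((geomFrame F (adelicGram F e TV TW) (isUnit_det_adelicGram F e hVd hWd) Ψ : piSchwartzBruhat F (Fin (n + n))) : (Fin (n + n) → AdeleRing (𝓞 F) F) → ℂ)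
      (diagAct F (adelicGram F e TV TW) (isUnit_det_adelicGram F e hVd hWd) g (ratPt F (Fin (n + n)) ξ))) h3
  rw [thetaDistLM_apply]
  exact (h2.symm.trans h4).trans (tsum_eq_apply_zero_add_orbitSum (vDiagAct F E c hcδ hδ hd N e TV hV hVd TW hW hWd) (geomFrame F (adelicGram F e TV TW) (isUnit_det_adelicGram F e hVd hWd) Ψ).2 h)

variable [LocallyCompactSpace (UnitaryGroup.adelic F E c N (TV.map (algebraMap F E)))]
  [CompactSpace (UnitaryGroup.adelic F E c N (TV.map (algebraMap F E)) ⧸ (UnitaryGroup.toAdelic F E c N (TV.map (algebraMap F E))).range)]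
  [MeasurableSpace (UnitaryGroup.adelic F E c N (TV.map (algebraMap F E)) ⧸ (UnitaryGroup.toAdelic F E c N (TV.map (algebraMap F E))).range)]
  [BorelSpace (UnitaryGroup.adelic F E c N (TV.map (algebraMap F E)) ⧸ (UnitaryGroup.toAdelic F E c N (TV.map (algebraMap F E))).range)]
  (ν : Measure (UnitaryGroup.adelic F E c N (TV.map (algebraMap F E)) ⧸ (UnitaryGroup.toAdelic F E c N (TV.map (algebraMap F E))).range)) [IsFiniteMeasure ν]

/-- **the theta-side orbit functional of the dual pair** `Λ_θ(Φ) = ∫_{[U(J_V)]} Σ'_{ξ ≠ 0} Φ(A_h̃ ξ) dν(h)` — ★ `orbitFunctional`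
at `A = vDiagAct` with its proved hypotheses `hA`, `hΓ`. [cite: Weil1965, n° 52] -/
def thetaOrbitFunctional : piSchwartzBruhat F (Fin (n + n)) →ₗ[ℂ] ℂ :=
  orbitFunctional F (UnitaryGroup.toAdelic F E c N (TV.map (algebraMap F E))).range ν (vDiagAct F E c hcδ hδ hd N e TV hV hVd TW hW hWd) (continuous_vDiagAct_apply F E c hcδ hδ hd N e TV hV hVd TW hW hWd) (vDiagAct_ratPt_of_mem F E c hcδ hδ hd N e TV hV hVd TW hW hWd)

/-- unfolding. [cite: Weil1965, n° 52] -/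
theorem thetaOrbitFunctional_eq : thetaOrbitFunctional F E c hcδ hδ hd N e TV hV hVd TW hW hWd ν =
    orbitFunctional F (UnitaryGroup.toAdelic F E c N (TV.map (algebraMap F E))).range ν (vDiagAct F E c hcδ hδ hd N e TV hV hVd TW hW hWd) (continuous_vDiagAct_apply F E c hcδ hδ hd N e TV hV hVd TW hW hWd) (vDiagAct_ratPt_of_mem F E c hcδ hδ hd N e TV hV hVd TW hW hWd) := rfl

/-- its real form `𝒮_ℝ(X□(𝔸)) →ₗ[ℝ] ℝ` (★ `orbitFunctionalReal`). [cite: Weil1965, Chap. I n° 2, Lemme 3, p. 7] -/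
def thetaOrbitFunctionalReal : piSchwartzBruhatReal F (Fin (n + n)) →ₗ[ℝ] ℝ :=
  orbitFunctionalReal F (UnitaryGroup.toAdelic F E c N (TV.map (algebraMap F E))).range ν (vDiagAct F E c hcδ hδ hd N e TV hV hVd TW hW hWd) (continuous_vDiagAct_apply F E c hcδ hδ hd N e TV hV hVd TW hW hWd) (vDiagAct_ratPt_of_mem F E c hcδ hδ hd N e TV hV hVd TW hW hWd)

/-- unfolding. [cite: Weil1965, Chap. I n° 2, Lemme 3, p. 7] -/
theorem thetaOrbitFunctionalReal_eq : thetaOrbitFunctionalReal F E c hcδ hδ hd N e TV hV hVd TW hW hWd ν =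
    orbitFunctionalReal F (UnitaryGroup.toAdelic F E c N (TV.map (algebraMap F E))).range ν (vDiagAct F E c hcδ hδ hd N e TV hV hVd TW hW hWd) (continuous_vDiagAct_apply F E c hcδ hδ hd N e TV hV hVd TW hW hWd) (vDiagAct_ratPt_of_mem F E c hcδ hδ hd N e TV hV hVd TW hW hWd) := rfl

/-- **POSITIVITY** — the `hS` of ★ `piSchwartzBruhatReal_sandwich`: the theta-side fibre measures come from ★ `sandwichMeasure`.
[cite: Weil1965, Chap. I n° 2, Lemme 3, p. 7] -/
theorem thetaOrbitFunctionalReal_nonneg (Ψ : piSchwartzBruhatReal F (Fin (n + n)))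
    (hΨ : 0 ≤ (Ψ : (Fin (n + n) → AdeleRing (𝓞 F) F) → ℝ)) : 0 ≤ thetaOrbitFunctionalReal F E c hcδ hδ hd N e TV hV hVd TW hW hWd ν Ψ :=
  orbitFunctionalReal_nonneg F (UnitaryGroup.toAdelic F E c N (TV.map (algebraMap F E))).range ν (vDiagAct F E c hcδ hδ hd N e TV hV hVd TW hW hWd) (continuous_vDiagAct_apply F E c hcδ hδ hd N e TV hV hVd TW hW hWd) (vDiagAct_ratPt_of_mem F E c hcδ hδ hd N e TV hV hVd TW hW hWd) Ψ hΨ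

/-- **INVARIANCE under `U(J_V)(𝔸)`**: `Λ_θ(Φ ∘ A_{h₀}) = Λ_θ(Φ)` for `ν` invariant. [cite: Weil1965, n° 45] -/
theorem thetaOrbitFunctional_comp
    [SMulInvariantMeasure (UnitaryGroup.adelic F E c N (TV.map (algebraMap F E))) (UnitaryGroup.adelic F E c N (TV.map (algebraMap F E)) ⧸ (UnitaryGroup.toAdelic F E c N (TV.map (algebraMap F E))).range) ν]
    (h₀ : UnitaryGroup.adelic F E c N (TV.map (algebraMap F E))) (Φ Φ' : piSchwartzBruhat F (Fin (n + n))) (hΦ' : ∀ x, (Φ' : (Fin (n + n) → AdeleRing (𝓞 F) F) → ℂ) x = (Φ : (Fin (n + n) → AdeleRing (𝓞 F) F) → ℂ) ((vDiagAct F E c hcδ hδ hd N e TV hV hVd TW hW hWd) h₀ x)) :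
    thetaOrbitFunctional F E c hcδ hδ hd N e TV hV hVd TW hW hWd ν Φ' =
      thetaOrbitFunctional F E c hcδ hδ hd N e TV hV hVd TW hW hWd ν Φ :=
  orbitFunctional_comp F (UnitaryGroup.toAdelic F E c N (TV.map (algebraMap F E))).range ν (vDiagAct F E c hcδ hδ hd N e TV hV hVd TW hW hWd) (continuous_vDiagAct_apply F E c hcδ hδ hd N e TV hV hVd TW hW hWd) (vDiagAct_ratPt_of_mem F E c hcδ hδ hd N e TV hV hVd TW hW hWd) h₀ Φ Φ' hΦ'

/-- **THE STRUCTURE IDENTITY OF THE DOUBLED THETA INTEGRAL (I-STRUCT-I)**: for every `Ψ ∈ 𝒮(𝔸_F^{n+n})`,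
`I□(Ψ) = ν([U(J_V)]) · Ψ♮(0) + Λ_θ(Ψ♮)`, where `I□(Ψ) = ∫_{[U(J_V)]} Θ(ω□(IV□ h̃⁻¹)Ψ) dν` is the child line's
`doubledThetaIntegral` (its `vDiagLift = doublingLift ∘ toSp ∘ adelicInl` unfolded; convention `h̃ = Quotient.out`), `Ψ♮ = geomFrame Ψ`
is the geometric frame (★ `AdelicDoublingGeometricFrame`; `Ψ♮(0) = ev0 Ψ` by ★ `geomFrame_apply_zero`) and `Λ_θ = thetaOrbitFunctional ν`
is the POSITIVE, `U(J_V)(𝔸)`-INVARIANT theta-side orbit functional (a positive Radon measure on `X□(𝔸)` by Weil's Lemme 3 ∕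
★ `sandwichMeasure`, carried by the `U(J_V)(𝔸)`-orbits of `X□(F) ∖ 0`). [cite: Weil1965, n° 52] -/
theorem doubledThetaIntegral_eq_measure_mul_apply_zero_add_thetaOrbitFunctional (Ψ : piSchwartzBruhat F (Fin (n + n))) :
    ∫ ξ, thetaDistLM F (Fin (n + n))
        (adelicMpCont.omega F (Fin (n + n)) (doubledGramFin F (adelicGram F e TV TW))
          (((doublingLift F (adelicGram F e TV TW) (isUnit_det_adelicGram F e hVd hWd)).comp (iotaV F E c hcδ hδ hd N e TV hV TW hW)) (Quotient.out ξ)⁻¹) Ψ) ∂ν =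
      (ν Set.univ).toReal * ((geomFrame F (adelicGram F e TV TW) (isUnit_det_adelicGram F e hVd hWd) Ψ : piSchwartzBruhat F (Fin (n + n))) : (Fin (n + n) → AdeleRing (𝓞 F) F) → ℂ) 0 +
        thetaOrbitFunctional F E c hcδ hδ hd N e TV hV hVd TW hW hWd ν (geomFrame F (adelicGram F e TV TW) (isUnit_det_adelicGram F e hVd hWd) Ψ) := by
  have hpt : ∀ ξ : UnitaryGroup.adelic F E c N (TV.map (algebraMap F E)) ⧸ (UnitaryGroup.toAdelic F E c N (TV.map (algebraMap F E))).range,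
      thetaDistLM F (Fin (n + n))
        (adelicMpCont.omega F (Fin (n + n)) (doubledGramFin F (adelicGram F e TV TW))
          (((doublingLift F (adelicGram F e TV TW) (isUnit_det_adelicGram F e hVd hWd)).comp (iotaV F E c hcδ hδ hd N e TV hV TW hW)) (Quotient.out ξ)⁻¹) Ψ) =
      ((geomFrame F (adelicGram F e TV TW) (isUnit_det_adelicGram F e hVd hWd) Ψ : piSchwartzBruhat F (Fin (n + n))) : (Fin (n + n) → AdeleRing (𝓞 F) F) → ℂ) 0 +
        orbitSumQuot F (UnitaryGroup.toAdelic F E c N (TV.map (algebraMap F E))).range (vDiagAct F E c hcδ hδ hd N e TV hV hVd TW hW hWd) (vDiagAct_ratPt_of_mem F E c hcδ hδ hd N e TV hV hVd TW hW hWd) ((geomFrame F (adelicGram F e TV TW) (isUnit_det_adelicGram F e hVd hWd) Ψ : piSchwartzBruhat F (Fin (n + n))) : (Fin (n + n) → AdeleRing (𝓞 F) F) → ℂ) ξ := fun ξ =>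
    (thetaDistLM_omega_vDiagLift_inv F E c hcδ hδ hd N e TV hV hVd TW hW hWd Ψ (Quotient.out ξ)).trans
      (congrArg (((geomFrame F (adelicGram F e TV TW) (isUnit_det_adelicGram F e hVd hWd) Ψ : piSchwartzBruhat F (Fin (n + n))) : (Fin (n + n) → AdeleRing (𝓞 F) F) → ℂ) 0 + ·) (orbitSum_out F (UnitaryGroup.toAdelic F E c N (TV.map (algebraMap F E))).range (vDiagAct F E c hcδ hδ hd N e TV hV hVd TW hW hWd) (vDiagAct_ratPt_of_mem F E c hcδ hδ hd N e TV hV hVd TW hW hWd) _ ξ))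
  rw [integral_congr_ae (Filter.Eventually.of_forall hpt), integral_add (integrable_const _)
    (integrable_orbitSumQuot F (UnitaryGroup.toAdelic F E c N (TV.map (algebraMap F E))).range ν (vDiagAct F E c hcδ hδ hd N e TV hV hVd TW hW hWd) (continuous_vDiagAct_apply F E c hcδ hδ hd N e TV hV hVd TW hW hWd) (vDiagAct_ratPt_of_mem F E c hcδ hδ hd N e TV hV hVd TW hW hWd) (geomFrame F (adelicGram F e TV TW) (isUnit_det_adelicGram F e hVd hWd) Ψ).2),
    integral_const, measureReal_def, Complex.real_smul]
  rfl

end DualPair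


/-! ## §4 The hermitian norm `hNorm` on `X□(𝔸)`: the invariant of the geometric action -/

section HermNorm

open scoped Kronecker

variable (F E : Type) [Field F] [NumberField F] [Field E] [NumberField E] [Algebra F E] [Algebra.IsQuadraticExtension F E]
  (c : E ≃ₐ[F] E) {δ : E} (hcδ : c δ = -δ) (hδ : δ ≠ 0) {d : F} (hd : δ * δ = algebraMap F E d)
  (N : ℕ) {n : ℕ} (e : Fin N × Fin 1 ≃ Fin n)
  (TV : Matrix (Fin N) (Fin N) F) (hV : TV.IsSymm) (hVd : IsUnit TV.det)
  (TW : Matrix (Fin 1) (Fin 1) F) (hW : TW.IsSymm) (hWd : IsUnit TW.det)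

/-- **the `𝔸_E`-coordinates of a point of `X□(𝔸)`**: `X□(𝔸) ≅ 𝕎_𝔸 ≅ Res(V ⊗ W)(𝔸) = 𝔸_E^{N×1}` through the
Darboux map (★ `AdelicDoublingGeometricFrame`: `X□ ≃ 𝕎`, `x ↦ θ_𝕋⁻¹(x ∘ e)`), the enumeration `e` and the coordinates
`reIm` of the quadratic extension. [cite: GelbartRogawski1991, §3.1 p. 454] -/
def toHermVec (x : (Fin (n + n) → AdeleRing (𝓞 F) F)) : Fin N × Fin 1 → AdeleRing (𝓞 E) E :=
  (reIm (quadraticAdeleEquiv F E c hcδ hδ).toAddEquiv (Fin N × Fin 1)).symm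
    ((reindexW (AdeleRing (𝓞 F) F) e).symm ((darboux (adelicGram F e TV TW) (isUnit_det_adelicGram F e hVd hWd)).symm (x ∘ ⇑finSumFinEquiv)))

/-- **the hermitian norm `hNorm x = re h(z, z)`**, `z = toHermVec x`, `h` the hermitian form of `J_V ⊗ J_W` (`re` = the
`F`-coordinate of `𝔸_E = 𝔸_F ⊕ 𝔸_F δ`; `h(z,z)` is `c`-fixed so nothing is lost) — Weil's `i_X` for `n = 1`: the
invariant whose fibres `hNorm⁻¹(b)` are the `U(b)_𝔸`. [cite: Weil1965, Chap. IV n° 41, (35) p. 59] -/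
def hNorm (x : (Fin (n + n) → AdeleRing (𝓞 F) F)) : AdeleRing (𝓞 F) F :=
  re (quadraticAdeleEquiv F E c hcδ hδ).toAddEquiv
    (UnitaryGroup.hermForm (UnitaryGroup.conjAdele F E c)
      (UnitaryGroup.adelicForm E N (TV.map (algebraMap F E)) ⊗ₖ UnitaryGroup.adelicForm E 1 (TW.map (algebraMap F E)))
      (toHermVec F E c hcδ hδ N e TV hVd TW hWd x) (toHermVec F E c hcδ hδ N e TV hVd TW hWd x))

/-- **the geometric action in `𝔸_E`-coordinates is `h ⊗ 1`**: `toHermVec (A_h x) = (h ⊗ 1) · toHermVec x`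
(★ `diagAct_apply_comp`, ★ `resAut_reIm`). [cite: GelbartRogawski1991, §3.1 p. 454] -/
theorem toHermVec_vDiagAct (h : UnitaryGroup.adelic F E c N (TV.map (algebraMap F E))) (x : (Fin (n + n) → AdeleRing (𝓞 F) F)) :
    (toHermVec F E c hcδ hδ N e TV hVd TW hWd ((vDiagAct F E c hcδ hδ hd N e TV hV hVd TW hW hWd) h x)) =
      (((UnitaryGroup.adelicInl F E c N 1 (TV.map (algebraMap F E)) (TW.map (algebraMap F E)) h :
        UnitaryGroup.adelicPair F E c N 1 (TV.map (algebraMap F E)) (TW.map (algebraMap F E))) :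
          GL (Fin N × Fin 1) (AdeleRing (𝓞 E) E)) : Matrix (Fin N × Fin 1) (Fin N × Fin 1) (AdeleRing (𝓞 E) E)) *ᵥ
        (toHermVec F E c hcδ hδ N e TV hVd TW hWd x) := by
  -- `z := toHermVec x`, so that `(W_e)⁻¹ (θ⁻¹ (x ∘ e')) = reIm z`
  set z := (toHermVec F E c hcδ hδ N e TV hVd TW hWd x) with hz
  have hre : (reindexW (AdeleRing (𝓞 F) F) e).symm ((darboux (adelicGram F e TV TW) (isUnit_det_adelicGram F e hVd hWd)).symm (x ∘ ⇑finSumFinEquiv)) =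
      reIm (quadraticAdeleEquiv F E c hcδ hδ).toAddEquiv (Fin N × Fin 1) z := by
    rw [hz, toHermVec, AddEquiv.apply_symm_apply]
  -- `A_h x ∘ e' = θ (ι_V h (θ⁻¹ (x ∘ e')))` and `ι_V h w = W_e (resAut (h ⊗ 1) (W_e⁻¹ w))`
  have h1 : ((vDiagAct F E c hcδ hδ hd N e TV hV hVd TW hW hWd) h x) ∘ ⇑finSumFinEquiv =
      darboux (adelicGram F e TV TW) (isUnit_det_adelicGram F e hVd hWd) ((((iotaV F E c hcδ hδ hd N e TV hV TW hW) h :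
        symplecticGroup (polar (adelicForm F (Fin n) (adelicGram F e TV TW)))) :
          ((Fin n → AdeleRing (𝓞 F) F) × (Fin n → AdeleRing (𝓞 F) F)) ≃ₗ[AdeleRing (𝓞 F) F] ((Fin n → AdeleRing (𝓞 F) F) × (Fin n → AdeleRing (𝓞 F) F))) ((darboux (adelicGram F e TV TW) (isUnit_det_adelicGram F e hVd hWd)).symm (x ∘ ⇑finSumFinEquiv))) :=
    diagAct_apply_comp F (adelicGram F e TV TW) (isUnit_det_adelicGram F e hVd hWd) _ x
  have h2 : ∀ w : ((Fin n → AdeleRing (𝓞 F) F) × (Fin n → AdeleRing (𝓞 F) F)), (((iotaV F E c hcδ hδ hd N e TV hV TW hW) h : symplecticGroup (polar (adelicForm F (Fin n) (adelicGram F e TV TW)))) :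
        ((Fin n → AdeleRing (𝓞 F) F) × (Fin n → AdeleRing (𝓞 F) F)) ≃ₗ[AdeleRing (𝓞 F) F] ((Fin n → AdeleRing (𝓞 F) F) × (Fin n → AdeleRing (𝓞 F) F))) w =
      reindexW (AdeleRing (𝓞 F) F) e ((isQuadraticCoordinates_adele E c hcδ hδ hd).resAut (Fin N × Fin 1)
        ((UnitaryGroup.adelicInl F E c N 1 (TV.map (algebraMap F E)) (TW.map (algebraMap F E)) h :
          UnitaryGroup.adelicPair F E c N 1 (TV.map (algebraMap F E)) (TW.map (algebraMap F E))) :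
            GL (Fin N × Fin 1) (AdeleRing (𝓞 E) E)) ((reindexW (AdeleRing (𝓞 F) F) e).symm w)) := fun w => rfl
  rw [toHermVec, h1, LinearEquiv.symm_apply_apply, h2, LinearEquiv.symm_apply_apply, hre,
    (isQuadraticCoordinates_adele E c hcδ hδ hd).resAut_reIm, AddEquiv.symm_apply_apply]

/-- **INVARIANCE of the hermitian norm under the geometric action**: `hNorm (A_h x) = hNorm x` — `h ⊗ 1` is unitary for
`J_V ⊗ J_W` (★ `hermForm_mulVec`, `mem_adelicPair_iff`). [cite: Weil1965, n° 45] -/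
theorem hNorm_vDiagAct (h : UnitaryGroup.adelic F E c N (TV.map (algebraMap F E))) (x : (Fin (n + n) → AdeleRing (𝓞 F) F)) :
    hNorm F E c hcδ hδ N e TV hVd TW hWd ((vDiagAct F E c hcδ hδ hd N e TV hV hVd TW hW hWd) h x) = hNorm F E c hcδ hδ N e TV hVd TW hWd x := by
  have hg := (UnitaryGroup.mem_adelicPair_iff F E c N 1 (TV.map (algebraMap F E)) (TW.map (algebraMap F E)) _).1
    (UnitaryGroup.adelicInl F E c N 1 (TV.map (algebraMap F E)) (TW.map (algebraMap F E)) h).2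
  unfold hNorm
  rw [toHermVec_vDiagAct, UnitaryGroup.hermForm_mulVec _ hg]

end HermNorm


/-! ## §5 Continuity of the hermitian norm -/

section HermNormCont

open scoped Kronecker

variable (F E : Type) [Field F] [NumberField F] [Field E] [NumberField E] [Algebra F E] [Algebra.IsQuadraticExtension F E]
  (c : E ≃ₐ[F] E) {δ : E} (hcδ : c δ = -δ) (hδ : δ ≠ 0) {d : F} (hd : δ * δ = algebraMap F E d)
  (N : ℕ) {n : ℕ} (e : Fin N × Fin 1 ≃ Fin n)
  (TV : Matrix (Fin N) (Fin N) F) (hV : TV.IsSymm) (hVd : IsUnit TV.det)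
  (TW : Matrix (Fin 1) (Fin 1) F) (hW : TW.IsSymm) (hWd : IsUnit TW.det)

/-- `x ↦ toHermVec x` is continuous (coordinate maps and the homeomorphism `𝔸_F × 𝔸_F ≃ 𝔸_E`). [folklore] -/
private theorem continuous_toHermVec :
    Continuous fun x : Fin (n + n) → AdeleRing (𝓞 F) F => toHermVec F E c hcδ hδ N e TV hVd TW hWd x := by
  unfold toHermVec
  refine continuous_pi fun i => ?_
  simp only [reIm_symm_apply, reindexW_symm_apply, darboux_symm_apply, Function.comp_apply]
  have h1 : Continuous fun x : Fin (n + n) → AdeleRing (𝓞 F) F => x (finSumFinEquiv (Sum.inl (e i))) :=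
    continuous_apply _
  have h2 : Continuous fun x : Fin (n + n) → AdeleRing (𝓞 F) F => fun j : Fin n => x (finSumFinEquiv (Sum.inr j)) :=
    continuous_pi fun j => continuous_apply _
  have h3 : Continuous fun x : Fin (n + n) → AdeleRing (𝓞 F) F =>
      ((adelicGram F e TV TW)⁻¹ *ᵥ fun j : Fin n => x (finSumFinEquiv (Sum.inr j))) (e i) :=
    (continuous_apply (e i)).comp (continuous_const.matrix_mulVec h2)
  exact (quadraticAdeleEquiv F E c hcδ hδ).continuous.comp (h1.prodMk h3)

/-- **`hNorm` is continuous** (hypothesis `hh` of ★ `Weil1965.fibreMeasure`'s API). [cite: Weil1965, Chap. IV n° 41, (35) p. 59] -/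
theorem continuous_hNorm : Continuous (hNorm F E c hcδ hδ N e TV hVd TW hWd) := by
  unfold hNorm UnitaryGroup.hermForm
  refine (continuous_re _ (quadraticAdeleEquiv F E c hcδ hδ).symm.continuous).comp ?_
  have hz := continuous_toHermVec F E c hcδ hδ N e TV hVd TW hWd
  refine Continuous.dotProduct ?_ (continuous_const.matrix_mulVec hz)
  exact continuous_pi fun i => (UnitaryGroup.continuous_conjAdele F E c).comp ((continuous_apply i).comp hz)

end HermNormCont

end Literature.NumberTheory.Weil1965.UnitaryDoubling
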